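import Summits.PneNP.PneNP.Theorems.ExpanderLinearGeneratorsGridRoutingDefs

/-!
# PneNP / ExpanderLinearGenerators — skeleton steps: deriving a substitution instance of a
constant-size tautology from derived instances of its hypotheses (grid routing reduction, engine)

Route `PneNP/ExpanderLinearGenerators`, support for crux stmt-PneNP-11443. Third file of the
Urquhart–Fu / Ben-Sasson reduction. The substituted Tseitin clauses of the routing grid mention
`Θ(k)` pigeonhole variables each, so the truth-table transfer of
`TseitinDepthFregeTransfer.lean` (cost `2^{#variables}`) does not apply directly. Instead every
local implication is a SUBSTITUTION INSTANCE of a tautology in at most three schematic variables: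

* `skeletonStep2S`, `skeletonStep1S` — let `Dsk` follow semantically from `G₁, G₂` (at most
  three variables in all); derive the skeleton sequent `⊢ Dsk, ¬G₁, ¬G₂` by truth table
  (`TextbookFrege.tautSeqS`, constant size), instantiate it by `θ` (`TextbookFrege.BD.subst`, size
  `× O(k)`), and cut the instances `¬Gᵢθ` away against given derivations `⊢ Gᵢθ, ¬R'`; result
  `⊢ Dsk θ, ¬R'` — `R'` being the big hypothesis (here `⋀ ontoPHP`), whose size only enters the
  line-size bound.
* `msum_ontoPhpClauses_le`, `ontoClauseExtractS` — size of the rendered bijective pigeonhole CNF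
  and extraction `⊢ C, ¬⋀ontoPHP` of its clauses in the shape used by the steps.

References: J. R. Shoenfield, *Mathematical Logic* (1967), §3.1; the bookkeeping follows
`TseitinDepthFregeTransfer.transferS` (GIRS 2023, Lemma 10). Folklore.
-/

namespace Summit.PneNP.PneNP.Theorems.GridRouting

set_option linter.dupNamespace false -- `Summit.PneNP.PneNP.…`: summit = sub-problem (D-0017)

open Finset Literature.Computability.Complexity.PropForm
open Literature.Computability.Complexity (PropForm Clause CNF Literal eventually_pow_lt_two_rpow_rpow)
open Literature.Computability.MetaComplexity Literature.Computability.MetaComplexity.TextbookFrege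
open Literature.Computability.MetaComplexity.KrajicekRamsey (litOf clauseOf ofCNF_eq_conjList
  subst_disjList size_subst_le altDepthAux_subst_le dd_clauseOf_le clauseExtractS dd_neg_ofCNF_le)

/-! ### Rendered clauses: semantics and small facts -/

/-- Unfolding the rendering of a clause. [folklore] -/
theorem clauseOf_cons (l : Literal ℕ) (c : Clause ℕ) :
    clauseOf (l :: c) = disj (litOf l) (clauseOf c) := by
  simp [clauseOf, disjList_cons]

/-- The empty clause renders as `⊥`. [folklore] -/
theorem clauseOf_nil : clauseOf ([] : Clause ℕ) = const false := rfl

/-- A positive literal renders as its variable. [folklore] -/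
theorem litOf_true (x : ℕ) : litOf (x, true) = var x := rfl

/-- Semantics of a rendered clause: some literal is true. [folklore] -/
theorem eval_clauseOf (σ : ℕ → Bool) (c : Clause ℕ) :
    (clauseOf c).eval σ = c.any (Literal.eval σ) := by
  induction c with
  | nil => rfl
  | cons l c ih =>
    rw [clauseOf_cons, PropForm.eval, ih, List.any_cons]
    congr 1
    rcases l with ⟨x, b⟩
    cases b <;> simp [litOf, PropForm.eval, Literal.eval]

/-- The size of the rendering of an all-positive clause on `m` variables is `2m + 1`. [folklore] -/
theorem size_clauseOf_map_true (f : ℕ → ℕ) (L : List ℕ) :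
    (clauseOf (L.map fun i => (f i, true))).size = 2 * L.length + 1 := by
  induction L with
  | nil => rfl
  | cons a L ih =>
    rw [List.map_cons, clauseOf_cons, List.length_cons, size, litOf_true, size, ih]
    ring

/-- Auxiliary depths of a rendered clause are at most `2`. [folklore] -/
theorem altDepthAux_clauseOf_le (c : Clause ℕ) (t : ℕ) : altDepthAux t (clauseOf c) ≤ 2 :=
  (altDepthAux_le_altDepth' t _).trans (altDepth_clauseOf_le c)

/-! ### The skeleton step -/

/-- `stepLines` is monotone. [folklore] -/
theorem stepLines_mono {m₁ m₁' m₂ m₂' : ℕ} (h₁ : m₁ ≤ m₁') (h₂ : m₂ ≤ m₂') :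
    stepLines m₁ m₂ ≤ stepLines m₁' m₂' := by
  unfold stepLines; omega

/-- **Skeleton step (two hypotheses).** Let `Dsk` be a semantic consequence of `G₁, G₂`, all
three over the `≤ 3` variables `V`, of alternation depth `≤ 3` and total size `≤ 64`; let `θ`
substitute formulas of size `≤ Z₁` and auxiliary depth `≤ 2`; and let `⊢ Gᵢθ, ¬R'` be derivable
in `mᵢ` lines. Then `⊢ Dsk θ, ¬R'` is derivable in `stepLines m₁ m₂` lines: the skeleton sequent
`⊢ Dsk, ¬G₁, ¬G₂` by truth table (`tautSeqS`), its `θ`-instance by substitution (`BD.subst`), and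
two cuts. [Shoenfield 1967, §3.1] [folklore] -/
theorem skeletonStep2S {D B m₁ m₂ Z₁ SR : ℕ} {R' Dsk G₁ G₂ : PropForm ℕ} {θ : ℕ → PropForm ℕ}
    (V : List ℕ) (hV : V.Nodup) (hV3 : V.length ≤ 3)
    (hvars : ∀ A ∈ [Dsk, neg G₁, neg G₂], ∀ x ∈ A.vars, x ∈ V)
    (htaut : ∀ τ : ℕ → Bool, G₁.eval τ = true → G₂.eval τ = true → Dsk.eval τ = true)
    (hq : ∀ A ∈ [Dsk, neg G₁, neg G₂], A.altDepth ≤ 3) (hS : msum [Dsk, neg G₁, neg G₂] ≤ 64)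
    (hθZ : ∀ x, (θ x).size ≤ Z₁) (hZ1 : 1 ≤ Z₁) (hθT : ∀ x c, altDepthAux c (θ x) ≤ 2)
    (hR : (neg R').dd ≤ 4) (hRsz : R'.size ≤ SR)
    (hyp₁ : BD D B m₁ (disjList [G₁.subst θ, neg R']))
    (hyp₂ : BD D B m₂ (disjList [G₂.subst θ, neg R']))
    (hD : 13 ≤ D) (hB : 2880 * Z₁ + 8 * SR + 100 ≤ B) :
    BD D B (stepLines m₁ m₂) (disjList [Dsk.subst θ, neg R']) := by
  set Γ := [Dsk, neg G₁, neg G₂] with hΓ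
  -- depth and size of the instances
  have hddθ : ∀ A ∈ Γ, (A.subst θ).dd ≤ 5 := fun A hA => by
    have h1 := altDepthAux_subst_le hθT A 3
    have h2 := altDepthAux_le_altDepth' 3 A
    have h3 := hq A hA
    unfold dd; omega
  have hszθ : ∀ A ∈ Γ, (A.subst θ).size + 1 ≤ 64 * Z₁ + 1 := fun A hA => by
    have h1 := size_subst_le hθZ hZ1 A
    have h2 : A.size < msum Γ := size_lt_msum hA
    have h3 : A.size * Z₁ ≤ 63 * Z₁ := Nat.mul_le_mul_right _ (by omega)
    omega
  -- (a) the skeleton sequent by truth table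
  have ha : BD 11 2880 (tautLines 3 64) (disjList Γ) := by
    refine tautSeqS Γ V hV (N := 3) (q := 3) (S₀ := 64) hV3 (by simp [hΓ]) hvars ?_ hq hS
      (by omega) (by omega)
    intro τ
    by_cases h1 : G₁.eval τ = true
    · by_cases h2 : G₂.eval τ = true
      · exact ⟨Dsk, by simp [hΓ], htaut τ h1 h2⟩
      · exact ⟨neg G₂, by simp [hΓ], by simpa [eval] using h2⟩
    · exact ⟨neg G₁, by simp [hΓ], by simpa [eval] using h1⟩
  -- (b) its instance under `θ`
  have hb : BD D B (tautLines 3 64) (disjList (Γ.map (PropForm.subst θ))) := by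
    have h := BD.subst (σ := θ) (T := 2) (Z := Z₁) hθT hθZ hZ1 ha
    rw [subst_disjList] at h
    exact h.weaken (by omega) (by nlinarith)
  have hmap : Γ.map (PropForm.subst θ) = [Dsk.subst θ, neg (G₁.subst θ), neg (G₂.subst θ)] := by
    rw [hΓ]; rfl
  rw [hmap] at hb
  set Dj := Dsk.subst θ with hDj
  set X₁ := G₁.subst θ with hX₁
  set X₂ := G₂.subst θ with hX₂
  have hddDj : Dj.dd ≤ 5 := hddθ Dsk (by simp [hΓ])
  have hszDj : Dj.size + 1 ≤ 64 * Z₁ + 1 := hszθ Dsk (by simp [hΓ])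
  have hddX₁ : (neg X₁).dd ≤ 5 := by
    have := hddθ (neg G₁) (by simp [hΓ]); simpa [PropForm.subst] using this
  have hddX₂ : (neg X₂).dd ≤ 5 := by
    have := hddθ (neg G₂) (by simp [hΓ]); simpa [PropForm.subst] using this
  have hszX₁ : X₁.size + 2 ≤ 64 * Z₁ + 1 := by
    have := hszθ (neg G₁) (by simp [hΓ]); simpa [PropForm.subst, size] using this
  have hszX₂ : X₂.size + 2 ≤ 64 * Z₁ + 1 := by
    have := hszθ (neg G₂) (by simp [hΓ]); simpa [PropForm.subst, size] using this
  have hddX₁' : X₁.dd ≤ 5 := by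
    rw [dd_neg] at hddX₁
    have := altDepthAux_le_altDepthAux_succ 3 1 X₁
    unfold dd; omega
  have hddX₂' : X₂.dd ≤ 5 := by
    rw [dd_neg] at hddX₂
    have := altDepthAux_le_altDepthAux_succ 3 1 X₂
    unfold dd; omega
  -- the common contexts
  have hctx : ∀ X ∈ [neg X₁, neg X₂, Dj, neg R'], X.dd ≤ 5 := by
    intro X hX
    simp only [List.mem_cons, List.not_mem_nil, or_false] at hX
    rcases hX with rfl | rfl | rfl | rfl
    · exact hddX₁
    · exact hddX₂
    · exact hddDj
    · omega
  -- (c) reorder to `⊢ ¬G₁θ, ¬G₂θ, Dj, ¬R'`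
  have hc : BD D B (tautLines 3 64 + 50 * (4 + 1) ^ 2) (disjList [neg X₁, neg X₂, Dj, neg R']) := by
    refine subsetN (N := 4) hb ?_ hctx (by omega) ?_ (by simp) (by simp)
    · intro X hX
      simp only [List.mem_cons, List.not_mem_nil, or_false] at hX ⊢
      tauto
    · simp only [size_disjList_cons, size_disjList_nil, size]
      omega
  -- (d) cut `¬G₁θ` against `hyp₁`
  have hd1 : BD D B (m₁ + 50 * (4 + 1) ^ 2) (disjList [X₁, neg X₂, Dj, neg R']) := by
    refine subsetN (N := 4) hyp₁ ?_ ?_ (p := 5) (by omega) ?_ (by simp) (by simp)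
    · intro X hX
      simp only [List.mem_cons, List.not_mem_nil, or_false] at hX ⊢
      tauto
    · intro X hX
      simp only [List.mem_cons, List.not_mem_nil, or_false] at hX
      rcases hX with rfl | rfl | rfl | rfl
      · exact hddX₁'
      · exact hddX₂
      · exact hddDj
      · omega
    · simp only [size_disjList_cons, size_disjList_nil, size]
      omega
  have hd2 : BD D B (m₁ + 50 * (4 + 1) ^ 2 + 6) (disjList [neg (neg X₁), neg X₂, Dj, neg R']) := by
    refine consNegNegS hd1 (hddX₁.trans (by omega)) ?_ ?_
    · refine (dd_neg_disjList_le (p := 5) fun Y hY => hctx Y (List.mem_cons_of_mem _ hY)).trans ?_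
      omega
    · simp only [size_disjList_cons, size_disjList_nil, size]
      omega
  have hd3 : BD D B (tautLines 3 64 + 50 * (4 + 1) ^ 2 + (m₁ + 50 * (4 + 1) ^ 2 + 6) + 2)
      (disjList [neg X₂, Dj, neg R']) :=
    cutS hc hd2 (by simp only [size_disjList_cons, size_disjList_nil, size]; omega)
  -- (e) cut `¬G₂θ` against `hyp₂`
  have he1 : BD D B (m₂ + 50 * (3 + 1) ^ 2) (disjList [X₂, Dj, neg R']) := by
    refine subsetN (N := 3) hyp₂ ?_ ?_ (p := 5) (by omega) ?_ (by simp) (by simp)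
    · intro X hX
      simp only [List.mem_cons, List.not_mem_nil, or_false] at hX ⊢
      tauto
    · intro X hX
      simp only [List.mem_cons, List.not_mem_nil, or_false] at hX
      rcases hX with rfl | rfl | rfl
      · exact hddX₂'
      · exact hddDj
      · omega
    · simp only [size_disjList_cons, size_disjList_nil, size]
      omega
  have he2 : BD D B (m₂ + 50 * (3 + 1) ^ 2 + 6) (disjList [neg (neg X₂), Dj, neg R']) := by
    refine consNegNegS he1 (hddX₂.trans (by omega)) ?_ ?_
    · refine (dd_neg_disjList_le (p := 5) fun Y hY => hctx Y
        (List.mem_cons_of_mem _ (List.mem_cons_of_mem _ hY))).trans ?_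
      omega
    · simp only [size_disjList_cons, size_disjList_nil, size]
      omega
  have he3 := cutS hd3 he2 (by simp only [size_disjList_cons, size_disjList_nil, size]; omega)
  refine he3.mono ?_
  unfold stepLines
  omega

/-- **Skeleton step (one hypothesis).** As `skeletonStep2S` with a single hypothesis `G₁`.
[Shoenfield 1967, §3.1] [folklore] -/
theorem skeletonStep1S {D B m₁ Z₁ SR : ℕ} {R' Dsk G₁ : PropForm ℕ} {θ : ℕ → PropForm ℕ}
    (V : List ℕ) (hV : V.Nodup) (hV3 : V.length ≤ 3)
    (hvars : ∀ A ∈ [Dsk, neg G₁], ∀ x ∈ A.vars, x ∈ V)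
    (htaut : ∀ τ : ℕ → Bool, G₁.eval τ = true → Dsk.eval τ = true)
    (hq : ∀ A ∈ [Dsk, neg G₁], A.altDepth ≤ 3) (hS : msum [Dsk, neg G₁] ≤ 64)
    (hθZ : ∀ x, (θ x).size ≤ Z₁) (hZ1 : 1 ≤ Z₁) (hθT : ∀ x c, altDepthAux c (θ x) ≤ 2)
    (hR : (neg R').dd ≤ 4) (hRsz : R'.size ≤ SR)
    (hyp₁ : BD D B m₁ (disjList [G₁.subst θ, neg R']))
    (hD : 13 ≤ D) (hB : 2880 * Z₁ + 8 * SR + 100 ≤ B) :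
    BD D B (stepLines m₁ 0) (disjList [Dsk.subst θ, neg R']) := by
  set Γ := [Dsk, neg G₁] with hΓ
  have hddθ : ∀ A ∈ Γ, (A.subst θ).dd ≤ 5 := fun A hA => by
    have h1 := altDepthAux_subst_le hθT A 3
    have h2 := altDepthAux_le_altDepth' 3 A
    have h3 := hq A hA
    unfold dd; omega
  have hszθ : ∀ A ∈ Γ, (A.subst θ).size + 1 ≤ 64 * Z₁ + 1 := fun A hA => by
    have h1 := size_subst_le hθZ hZ1 A
    have h2 : A.size < msum Γ := size_lt_msum hA
    have h3 : A.size * Z₁ ≤ 63 * Z₁ := Nat.mul_le_mul_right _ (by omega)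
    omega
  have ha : BD 11 2880 (tautLines 3 64) (disjList Γ) := by
    refine tautSeqS Γ V hV (N := 3) (q := 3) (S₀ := 64) hV3 (by simp [hΓ]) hvars ?_ hq hS
      (by omega) (by omega)
    intro τ
    by_cases h1 : G₁.eval τ = true
    · exact ⟨Dsk, by simp [hΓ], htaut τ h1⟩
    · exact ⟨neg G₁, by simp [hΓ], by simpa [eval] using h1⟩
  have hb : BD D B (tautLines 3 64) (disjList (Γ.map (PropForm.subst θ))) := by
    have h := BD.subst (σ := θ) (T := 2) (Z := Z₁) hθT hθZ hZ1 ha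
    rw [subst_disjList] at h
    exact h.weaken (by omega) (by nlinarith)
  have hmap : Γ.map (PropForm.subst θ) = [Dsk.subst θ, neg (G₁.subst θ)] := by rw [hΓ]; rfl
  rw [hmap] at hb
  set Dj := Dsk.subst θ with hDj
  set X₁ := G₁.subst θ with hX₁
  have hddDj : Dj.dd ≤ 5 := hddθ Dsk (by simp [hΓ])
  have hszDj : Dj.size + 1 ≤ 64 * Z₁ + 1 := hszθ Dsk (by simp [hΓ])
  have hddX₁ : (neg X₁).dd ≤ 5 := by
    have := hddθ (neg G₁) (by simp [hΓ]); simpa [PropForm.subst] using this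
  have hszX₁ : X₁.size + 2 ≤ 64 * Z₁ + 1 := by
    have := hszθ (neg G₁) (by simp [hΓ]); simpa [PropForm.subst, size] using this
  have hddX₁' : X₁.dd ≤ 5 := by
    rw [dd_neg] at hddX₁
    have := altDepthAux_le_altDepthAux_succ 3 1 X₁
    unfold dd; omega
  have hctx : ∀ X ∈ [neg X₁, Dj, neg R'], X.dd ≤ 5 := by
    intro X hX
    simp only [List.mem_cons, List.not_mem_nil, or_false] at hX
    rcases hX with rfl | rfl | rfl
    · exact hddX₁
    · exact hddDj
    · omega
  have hc : BD D B (tautLines 3 64 + 50 * (3 + 1) ^ 2) (disjList [neg X₁, Dj, neg R']) := by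
    refine subsetN (N := 3) hb ?_ hctx (by omega) ?_ (by simp) (by simp)
    · intro X hX
      simp only [List.mem_cons, List.not_mem_nil, or_false] at hX ⊢
      tauto
    · simp only [size_disjList_cons, size_disjList_nil, size]
      omega
  have hd1 : BD D B (m₁ + 50 * (3 + 1) ^ 2) (disjList [X₁, Dj, neg R']) := by
    refine subsetN (N := 3) hyp₁ ?_ ?_ (p := 5) (by omega) ?_ (by simp) (by simp)
    · intro X hX
      simp only [List.mem_cons, List.not_mem_nil, or_false] at hX ⊢
      tauto
    · intro X hX
      simp only [List.mem_cons, List.not_mem_nil, or_false] at hX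
      rcases hX with rfl | rfl | rfl
      · exact hddX₁'
      · exact hddDj
      · omega
    · simp only [size_disjList_cons, size_disjList_nil, size]
      omega
  have hd2 : BD D B (m₁ + 50 * (3 + 1) ^ 2 + 6) (disjList [neg (neg X₁), Dj, neg R']) := by
    refine consNegNegS hd1 (hddX₁.trans (by omega)) ?_ ?_
    · refine (dd_neg_disjList_le (p := 5) fun Y hY => hctx Y (List.mem_cons_of_mem _ hY)).trans ?_
      omega
    · simp only [size_disjList_cons, size_disjList_nil, size]
      omega
  have hd3 := cutS hc hd2 (by simp only [size_disjList_cons, size_disjList_nil, size]; omega)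
  refine hd3.mono ?_
  unfold stepLines
  omega

end Summit.PneNP.PneNP.Theorems.GridRouting
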